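import Summits.BirchSwinnertonDyer.BirchSwinnertonDyer.Theorems.CyclotomicUntwistUntwistingIdentityAllLevels
import Summits.BirchSwinnertonDyer.BirchSwinnertonDyer.Theorems.CyclotomicUntwistPrimePowerGaussSum
import Summits.BirchSwinnertonDyer.BirchSwinnertonDyer.Theorems.CyclotomicUntwistFiniteSlopeValueAtOne
import HarnessLib

/-!
# The route's one tame level: the untwisting constant at conductor `27` is NON-ZERO
# (`J₃(η, χ) · J₃' = 9` for `η` primitive mod `9`, `χ` primitive mod `27`)

Cell `pub/bsd-wall` (D-0145 line `route-BirchSwinnertonDyer-CyclotomicUntwist`), seat `bsd-line-cycu-p1`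
(prover seat 1/3, K1 base), helper toward crux K1 `PSRankOneLowerHalfAtThree`
(stmt-BirchSwinnertonDyer-21580). THEOREMS ONLY (no definition, no named fact, no `sorry`); BSD is not
proved by this file and no crux is.

For the route (`p = 3`, `c = 2`) the interpolation values of D1's `𝓛^η` at a character `ξ` of conductor
`3ⁿ` are, by `CyclotomicUntwistUntwistingIdentityAllLevels` (`n > 2`) and `…Jacobi` (`n = 2`), explicit
multiples of the ordinary twisted symbol sum `∑ ξ(a)[a/3ⁿ]⁺_f`; the multiplier's character sum is a Gauss
sum for `n ≥ 4` (non-zero: `PSPrimePowerGauss`), a Jacobi sum for `n = 2` (non-zero: `…Jacobi`), and for the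
single remaining level `n = 3` the sum `J₃(η, χ) = ∑_{b mod 9} η(b) χ(1 + 3b)`. THIS FILE proves `J₃ ≠ 0`
(`charSum27_ne_zero`) by an explicit certificate: with `z = η(2)` (`1 + z² + z⁴ = 0`, cycu-p2's
`one_add_sq_add_fourth_eq_zero`) and `w = χ(4)` (`1 + w³ + w⁶ = 0`: `w³ = χ(10) ≠ 1` by
`PSPrimePowerGauss.apply_one_add_pow_ne_one`, `χ(10)³ = χ(1000) = 1`),
`J₃ = w + z w⁸ + z² w⁴ + z⁵ w² + z⁴ w⁷ + z³ w⁵` (`charSum27_eq`: `1 + 3b ∈ {4, 7, 13, 16, 22, 25} = 4^{1,8,4,2,7,5}`)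
and `J₃ · (w⁸ + z⁵ w + z⁴ w⁵ + z w⁷ + z² w² + z³ w⁴) = 9` (`charSum27_mul_conj`, a `linear_combination` of the two
cyclotomic relations with integer polynomial coefficients found by polynomial division). Consequence
(`gammaCharValue_eq_of_conductor_27`): at every `ξ` of conductor `27`, `∫_Γ ξ dμ = e₃(α)·η(−1)·J₃·∑ξ(a)[a/27]⁺_f`
with `J₃ ≠ 0`. With this, EVERY interpolation value of the route's D1 object at a non-trivial character is a
non-zero explicit multiple of a Birch sum of `f_W` (conductor `9`: Jacobi; `27`: here; `≥ 81`: Gauss).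

References: [cite: MazurTateTeitelbaum1986Invent, §I.14 (case p ∣ N)]; [folklore].
-/

noncomputable section

open scoped MatrixGroups

open CongruenceSubgroup DirichletCharacter Literature.NumberTheory.EllipticCurves
  Literature.NumberTheory.EllipticCurves.ModularForms Literature.NumberTheory.IwasawaTheory
  Summit.BirchSwinnertonDyer.BirchSwinnertonDyer.Theorems.PSUntwisting
  Summit.BirchSwinnertonDyer.BirchSwinnertonDyer.Theorems.PSUntwistingAll
  Summit.BirchSwinnertonDyer.BirchSwinnertonDyer.Theorems.PSPrimePowerGauss
  Summit.BirchSwinnertonDyer.BirchSwinnertonDyer.Theorems.CyclotomicUntwistValueAtOne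

-- single-conjunct summit: `Summit.BirchSwinnertonDyer.BirchSwinnertonDyer.…` repeats the name by design
set_option linter.dupNamespace false
set_option autoImplicit false

namespace Summit.BirchSwinnertonDyer.BirchSwinnertonDyer.Theorems.PSUntwistingTwentySeven

variable (η : DirichletCharacter ℂ_[3] (3 ^ 2)) (χ : DirichletCharacter ℂ_[3] (3 ^ 3))

/-! ### §1 The character `χ` mod `27` on `1 + 3ℤ/27 = ⟨4⟩`: powers of `w = χ(4)` -/

/-- `1 + 3b` for `b = 1, 2, 4, 5, 7, 8` is `4, 7, 13, 16, 22, 25 = 4¹, 4⁸, 4⁴, 4², 4⁷, 4⁵` in `ℤ/27`, and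
`3·0, 3·3, 3·6` give the non-units' rows (irrelevant: `η` vanishes there). [folklore] -/
theorem one_add_three_mul_table :
    (1 : ZMod (3 ^ 3)) + ((3 ^ (3 - 2) : ℕ) : ZMod (3 ^ 3)) * ((1 : ℕ) : ZMod (3 ^ 3)) = ((4 : ℕ) : ZMod (3 ^ 3)) ^ 1 ∧
    (1 : ZMod (3 ^ 3)) + ((3 ^ (3 - 2) : ℕ) : ZMod (3 ^ 3)) * ((2 : ℕ) : ZMod (3 ^ 3)) = ((4 : ℕ) : ZMod (3 ^ 3)) ^ 8 ∧
    (1 : ZMod (3 ^ 3)) + ((3 ^ (3 - 2) : ℕ) : ZMod (3 ^ 3)) * ((4 : ℕ) : ZMod (3 ^ 3)) = ((4 : ℕ) : ZMod (3 ^ 3)) ^ 4 ∧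
    (1 : ZMod (3 ^ 3)) + ((3 ^ (3 - 2) : ℕ) : ZMod (3 ^ 3)) * ((5 : ℕ) : ZMod (3 ^ 3)) = ((4 : ℕ) : ZMod (3 ^ 3)) ^ 2 ∧
    (1 : ZMod (3 ^ 3)) + ((3 ^ (3 - 2) : ℕ) : ZMod (3 ^ 3)) * ((7 : ℕ) : ZMod (3 ^ 3)) = ((4 : ℕ) : ZMod (3 ^ 3)) ^ 7 ∧
    (1 : ZMod (3 ^ 3)) + ((3 ^ (3 - 2) : ℕ) : ZMod (3 ^ 3)) * ((8 : ℕ) : ZMod (3 ^ 3)) = ((4 : ℕ) : ZMod (3 ^ 3)) ^ 5 := by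
  decide

/-- `w³ = χ(4)³ = χ(10)` and `χ(10)³ = 1` (`4³ = 64 ≡ 10`, `10³ ≡ 1 mod 27`). [folklore] -/
theorem chi_four_pow_three : χ ((4 : ℕ) : ZMod (3 ^ 3)) ^ 3 = χ ((10 : ℕ) : ZMod (3 ^ 3)) ∧
    χ ((10 : ℕ) : ZMod (3 ^ 3)) ^ 3 = 1 := by
  have h1 : ((4 : ℕ) : ZMod (3 ^ 3)) ^ 3 = ((10 : ℕ) : ZMod (3 ^ 3)) := by decide
  have h2 : ((10 : ℕ) : ZMod (3 ^ 3)) ^ 3 = 1 := by decide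
  exact ⟨by rw [← map_pow, h1], by rw [← map_pow, h2, map_one]⟩

/-- **For `χ` PRIMITIVE mod `27`: `1 + w³ + w⁶ = 0`** with `w = χ(4)` — `w³ = χ(10) ≠ 1`
(`apply_one_add_pow_ne_one`: a primitive character mod `3³` is non-trivial at `1 + 3²`) and `(w³)³ = 1`.
[folklore] -/
theorem one_add_cube_add_sixth_eq_zero (hχ : χ.IsPrimitive) :
    1 + χ ((4 : ℕ) : ZMod (3 ^ 3)) ^ 3 + χ ((4 : ℕ) : ZMod (3 ^ 3)) ^ 6 = 0 := by
  obtain ⟨h3, h9⟩ := chi_four_pow_three χ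
  have hne : χ ((10 : ℕ) : ZMod (3 ^ 3)) ≠ 1 := by
    have h := apply_one_add_pow_ne_one (p := 3) (n := 3) χ (by norm_num) hχ
    have e : (1 : ZMod (3 ^ 3)) + ((3 ^ (3 - 1) : ℕ) : ZMod (3 ^ 3)) = ((10 : ℕ) : ZMod (3 ^ 3)) := by decide
    rwa [e] at h
  have hsix : χ ((4 : ℕ) : ZMod (3 ^ 3)) ^ 6 = χ ((10 : ℕ) : ZMod (3 ^ 3)) ^ 2 := by
    rw [show (6 : ℕ) = 3 * 2 by norm_num, pow_mul, h3]
  rw [h3, hsix]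
  have hprod : (χ ((10 : ℕ) : ZMod (3 ^ 3)) - 1) *
      (1 + χ ((10 : ℕ) : ZMod (3 ^ 3)) + χ ((10 : ℕ) : ZMod (3 ^ 3)) ^ 2) = 0 := by
    linear_combination h9
  exact (mul_eq_zero.mp hprod).resolve_left (sub_ne_zero.mpr hne)

/-! ### §2 The character sum `J₃(η, χ) = ∑_{b mod 9} η(b) χ(1 + 3b)` explicitly -/

/-- **`J₃ = w + z w⁸ + z² w⁴ + z⁵ w² + z⁴ w⁷ + z³ w⁵`** (`z = η(2)`, `w = χ(4)`): expand over `ℤ/9`, drop the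
non-units `0, 3, 6` (`η = 0`), and read `η(b) = z^{ind₂ b}`, `χ(1 + 3b) = w^{ind₄(1+3b)}`. [folklore] -/
theorem charSum27_eq :
    ∑ b : ZMod (3 ^ 2), η b * χ (1 + ((3 ^ (3 - 2) : ℕ) : ZMod (3 ^ 3)) * ((b.val : ℕ) : ZMod (3 ^ 3))) =
      χ ((4 : ℕ) : ZMod (3 ^ 3)) + η 2 * χ ((4 : ℕ) : ZMod (3 ^ 3)) ^ 8 +
        η 2 ^ 2 * χ ((4 : ℕ) : ZMod (3 ^ 3)) ^ 4 + η 2 ^ 5 * χ ((4 : ℕ) : ZMod (3 ^ 3)) ^ 2 +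
        η 2 ^ 4 * χ ((4 : ℕ) : ZMod (3 ^ 3)) ^ 7 + η 2 ^ 3 * χ ((4 : ℕ) : ZMod (3 ^ 3)) ^ 5 := by
  obtain ⟨e1, e2, e4, e5, e7, e8, -⟩ := eta_table η
  obtain ⟨n0, n3, n6⟩ := eta_nonunit η
  obtain ⟨t1, t2, t4, t5, t7, t8⟩ := one_add_three_mul_table
  rw [sum_univ_zmod_nine]
  simp only [Finset.sum_range_succ, Finset.sum_range_zero, zero_add, ZMod.val_natCast, three_sq,
    Nat.reduceMod]
  rw [n0, n3, n6, e1, e2, e4, e5, e7, e8, t1, t2, t4, t5, t7, t8]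
  simp only [map_pow, zero_mul, add_zero, zero_add, one_mul, pow_one]

/-- **The certificate**: `J₃ · J₃' = 9` with `J₃' = w⁸ + z⁵w + z⁴w⁵ + zw⁷ + z²w² + z³w⁴`, for `η` primitive mod
`9` and `χ` primitive mod `27` — an identity in `ℤ[z, w]` modulo `1 + z² + z⁴` and `1 + w³ + w⁶` (coefficients
found by polynomial division; checked by `linear_combination`). [folklore] -/
theorem charSum27_mul_conj (hη : η.IsPrimitive) (hχ : χ.IsPrimitive) :
    (χ ((4 : ℕ) : ZMod (3 ^ 3)) + η 2 * χ ((4 : ℕ) : ZMod (3 ^ 3)) ^ 8 +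
        η 2 ^ 2 * χ ((4 : ℕ) : ZMod (3 ^ 3)) ^ 4 + η 2 ^ 5 * χ ((4 : ℕ) : ZMod (3 ^ 3)) ^ 2 +
        η 2 ^ 4 * χ ((4 : ℕ) : ZMod (3 ^ 3)) ^ 7 + η 2 ^ 3 * χ ((4 : ℕ) : ZMod (3 ^ 3)) ^ 5) *
      (χ ((4 : ℕ) : ZMod (3 ^ 3)) ^ 8 + η 2 ^ 5 * χ ((4 : ℕ) : ZMod (3 ^ 3)) +
        η 2 ^ 4 * χ ((4 : ℕ) : ZMod (3 ^ 3)) ^ 5 + η 2 * χ ((4 : ℕ) : ZMod (3 ^ 3)) ^ 7 +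
        η 2 ^ 2 * χ ((4 : ℕ) : ZMod (3 ^ 3)) ^ 2 + η 2 ^ 3 * χ ((4 : ℕ) : ZMod (3 ^ 3)) ^ 4) = 9 := by
  have hz := one_add_sq_add_fourth_eq_zero η hη
  have hw := one_add_cube_add_sixth_eq_zero χ hχ
  set z : ℂ_[3] := η 2 with hzdef
  set w : ℂ_[3] := χ ((4 : ℕ) : ZMod (3 ^ 3)) with hwdef
  linear_combination (-8 - 1 * z^1 * w^1 - 1 * z^1 * w^2 - 1 * z^1 * w^4 - 1 * z^1 * w^5 + 7 * z^2 +
      1 * z^2 * w^3 + 2 * z^3 * w^1 + 2 * z^3 * w^2 + 2 * z^3 * w^4 + 2 * z^3 * w^5 - 2 * z^4 -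
      2 * z^4 * w^3 - 1 * z^5 * w^1 - 1 * z^5 * w^2 - 1 * z^5 * w^4 - 1 * z^5 * w^5 + 1 * z^6 * w^3) * hz +
    (-1 + 1 * w^3 + 1 * z^1 * w^1 + 1 * z^1 * w^2 - 1 * z^1 * w^7 + 1 * z^1 * w^10 + 1 * z^2 - 1 * z^2 * w^3 +
      1 * z^2 * w^9 - 1 * z^3 * w^1 - 1 * z^3 * w^2 + 1 * z^3 * w^5 + 1 * z^3 * w^7 + 3 * z^4 - 2 * z^4 * w^3 +
      1 * z^4 * w^6 + 1 * z^4 * w^9 + 1 * z^5 * w^2 - 1 * z^5 * w^5 + 1 * z^5 * w^7 + 1 * z^5 * w^8 - 5 * z^6 +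
      5 * z^6 * w^3 - 1 * z^7 * w^1 - 1 * z^7 * w^2 + 1 * z^7 * w^4 + 1 * z^7 * w^5 + 2 * z^8 - 1 * z^8 * w^3 +
      1 * z^8 * w^6 + 1 * z^9 * w^1 + 1 * z^9 * w^2) * hw

/-- **`J₃(η, χ) ≠ 0`** for `η` primitive mod `9` and `χ` primitive mod `27`. [folklore] -/
theorem charSum27_ne_zero (hη : η.IsPrimitive) (hχ : χ.IsPrimitive) :
    ∑ b : ZMod (3 ^ 2), η b * χ (1 + ((3 ^ (3 - 2) : ℕ) : ZMod (3 ^ 3)) * ((b.val : ℕ) : ZMod (3 ^ 3))) ≠ 0 := by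
  rw [charSum27_eq]
  intro h0
  have h := charSum27_mul_conj η χ hη hχ
  rw [h0, zero_mul] at h
  norm_num at h

/-! ### §3 Consequence for the route's D1 object at conductor `27` -/

section Interpolation

variable {N : ℕ} [NeZero N] {f : CuspForm (Gamma0 N) 2} {α : ℂ_[3]} {μ : (n : ℕ) → ZMod (3 ^ n) → ℂ_[3]}
variable {η}

/-- **At conductor `27` the interpolation value is a NON-ZERO multiple of the Birch sum.** For `μ` with
`IsUntwistedPAdicLFunction 3 f η α μ`, `η` primitive mod `9`, `ξ` primitive even of `3`-power order mod `27`
and `χ` primitive mod `27` agreeing with `η⁻¹ξ` off `3`: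
`∫_Γ ξ dμ = e₃(α) · (η(−1) · J₃(η,χ)) · ∑_{a mod 27} ξ(a)[a/27]⁺_f` with `η(−1) · J₃(η,χ) ≠ 0`.
[cite: MazurTateTeitelbaum1986Invent, §I.14 (case p ∣ N)] -/
theorem gammaCharValue_eq_of_conductor_27 (hμ : IsUntwistedPAdicLFunction 3 f η α μ) (hη : η.IsPrimitive)
    (ξ : DirichletCharacter ℂ_[3] (3 ^ 3)) (hξ : ξ.IsPrimitive) (hξe : ξ.Even)
    (hξo : ∃ j : ℕ, orderOf ξ = 3 ^ j) (χ : DirichletCharacter ℂ_[3] (3 ^ 3)) (hχ : χ.IsPrimitive)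
    (hcompat : ∀ a : ℕ, a.Coprime 3 → χ (a : ZMod (3 ^ 3)) = (η (a : ZMod (3 ^ 2)))⁻¹ * ξ (a : ZMod (3 ^ 3))) :
    gammaCharValue 3 μ ξ = untwistMultiplier 3 α 3 *
      (η (-1) * (∑ b : ZMod (3 ^ 2), η b * χ (1 + ((3 ^ (3 - 2) : ℕ) : ZMod (3 ^ 3)) * ((b.val : ℕ) : ZMod (3 ^ 3)))) *
        ratTwistedSymbolSum f ξ) ∧
    η (-1) * (∑ b : ZMod (3 ^ 2), η b * χ (1 + ((3 ^ (3 - 2) : ℕ) : ZMod (3 ^ 3)) * ((b.val : ℕ) : ZMod (3 ^ 3)))) ≠ 0 := by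
  refine ⟨gammaCharValue_eq_charSum (p := 3) hμ (by norm_num) (by norm_num) ξ hξ hξe hξo χ hχ hcompat, ?_⟩
  have hη1 : η (-1) ≠ 0 := by
    have h : η (-1) * η (-1) = 1 := by rw [← map_mul, neg_mul_neg, one_mul, map_one]
    intro h'
    rw [h', zero_mul] at h
    exact zero_ne_one h
  exact mul_ne_zero hη1 (charSum27_ne_zero η χ hη hχ)

end Interpolation

end Summit.BirchSwinnertonDyer.BirchSwinnertonDyer.Theorems.PSUntwistingTwentySeven
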